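import Summits.AnomalousDissipation.AnomalousDissipation.Theorems.MirrorVarietyTaylorGreenLoudGalerkinStatesStubTruncation
import Summits.AnomalousDissipation.AnomalousDissipation.Theorems.MirrorVarietyTaylorGreenLoudGalerkinStatesStubDiscreteInfSup
import Summits.AnomalousDissipation.AnomalousDissipation.Theorems.MirrorVarietyTaylorGreenLoudGalerkinStatesStubDiscreteKantorovich

/-!
# Stub `stub_galerkinNewton` of the line `stagnation-plug-froth`
# (crux stmt-AnomalousDissipation-2987, `MirrorVariety.TaylorGreenLoudGalerkinStates`) — the lead's glue

The registered transfer stub of the line (Brezzi–Rappaz–Raviart + Newton–Kantorovich, general smooth force): a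
Newton-ready `K`-symmetric quasi-solution `v` of steady NS(`ν`, `f`) at fixed `ν > 0` — energy `≤ E₁`, loudness
`ε₁ ≤ ν‖∇v‖²`, `K`-residual `≤ η`, `K`-inf-sup constant `M`, and the smallness `M²η ≤ c`, `(Mη)² ≤ cE₁`, `ν(Mη)² ≤ cε₁`
with a UNIVERSAL `c` — has, for all large `N`, a band-limited `K`-field solving the `K`-tested Galerkin equations with
`∫|U|² ≤ 4E₁` and `ν‖∇U‖² ≥ ε₁/4`.

It is obtained here by GLUING the three landed pieces of the lead's reshape (v2):
* `Truncation.stub_truncation` (p85290): the truncation `P_N v` is a band-limited `K`-field with energy `≤ E₁`, loudness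
  `≥ ε₁/2` and `K`-Galerkin residual `≤ η + δE₁`, eventually in `N`, for every slack `δ > 0`;
* `DiscreteInfSup.stub_discreteInfSup` (p84898): the discrete inf-sup constant `2M` for `linForm ν (P_N v)`, eventually in `N`;
* `DiscreteKantorovich.stub_discreteKantorovich` (p87441): finite-dimensional Newton–Kantorovich from discrete data with its
  universal constant `c_D`, margins `2E`, `ε/2`.
The glue is real arithmetic: with `c := c_D/32` and a slack `δ ≤ min(1/2, c_D/(8(M²+1)(E₁+1)))` (and, when `ε₁ > 0`, also
`δ ≤ c_Dε₁/(64ν(M²+1)(E₁+1)²)`), the discrete data `(η', M') = (η + δE₁, 2M)` satisfy `M'²η' ≤ c_D`, `(M'η')² ≤ c_DE₁` and (if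
`ε₁ > 0`) `ν(M'η')² ≤ c_D(ε₁/2)`; the Kantorovich stub applied with `(E, ε) := (E₁, ε₁/2)` gives `∫|U|² ≤ 2E₁ ≤ 4E₁` and
`ν‖∇U‖² ≥ ε₁/4` (trivially when `ε₁ ≤ 0`).

References: F. Brezzi, J. Rappaz, P.-A. Raviart, Numer. Math. 36 (1980) 1–25, Part I; V. Girault, P.-A. Raviart,
*Finite Element Methods for Navier–Stokes Equations* (1986) Ch. IV §3; the lead's skeleton
`Cruxes/TaylorGreenLoudGalerkinStates/Lines/stagnation-plug-froth.lean`.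
-/

-- `Summit.<Summit>.<Problem>` is the tree's mandated summit-side namespace (CONVENTIONS §2); for this
-- single-conjunct summit the two coincide, so the duplicate is deliberate.
set_option linter.dupNamespace false

noncomputable section

open scoped BigOperators Topology InnerProductSpace
open Filter MeasureTheory
open Literature.Analysis.FunctionSpaces Literature.Analysis.FunctionSpaces.Torus

namespace Summit.AnomalousDissipation.AnomalousDissipation.Theorems.TaylorGreenLoudGalerkinStates.GalerkinNewton

open Summit.AnomalousDissipation.AnomalousDissipation.Theorems.TaylorGreenLoudGalerkinStates
open Summit.AnomalousDissipation.AnomalousDissipation.Theorems.TaylorGreenLoudGalerkinStates.Negative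
open Summit.AnomalousDissipation.AnomalousDissipation.Theorems.TaylorGreenLoudGalerkinStates.Truncation
open Summit.AnomalousDissipation.AnomalousDissipation.Theorems.TaylorGreenLoudGalerkinStates.DiscreteInfSup
open Summit.AnomalousDissipation.AnomalousDissipation.Theorems.TaylorGreenLoudGalerkinStates.DiscreteKantorovich

/-! ## §1 Elementary real arithmetic of the smallness constants -/

/-- `(a + b)² ≤ 2a² + 2b²`. [folklore] -/
theorem add_sq_le_two_mul (a b : ℝ) : (a + b) ^ 2 ≤ 2 * a ^ 2 + 2 * b ^ 2 := by
  nlinarith [sq_nonneg (a - b)]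

/-- First two discrete smallness inequalities.  If `M²η ≤ c_D/32`, `(Mη)² ≤ (c_D/32)E₁`, `0 ≤ E₁`, `0 < δ ≤ 1/2` and
`8(M²+1)(E₁+1)δ ≤ c_D`, then `(2M)²(η + δE₁) ≤ c_D` and `((2M)(η + δE₁))² ≤ c_DE₁`. [folklore] -/
theorem discrete_smallness {cD M η E₁ δ : ℝ} (hE0 : 0 ≤ E₁) (hδ0 : 0 < δ) (hδhalf : δ ≤ 1 / 2)
    (hδA : 8 * (M ^ 2 + 1) * (E₁ + 1) * δ ≤ cD)
    (hs1 : M ^ 2 * η ≤ cD / 32) (hs2 : (M * η) ^ 2 ≤ cD / 32 * E₁) :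
    (2 * M) ^ 2 * (η + δ * E₁) ≤ cD ∧ ((2 * M) * (η + δ * E₁)) ^ 2 ≤ cD * E₁ := by
  have hM2 : 0 ≤ M ^ 2 := sq_nonneg M
  have hcD : 0 ≤ cD := by
    have : 0 ≤ 8 * (M ^ 2 + 1) * (E₁ + 1) * δ := by positivity
    linarith
  -- `8 M² δ E₁ ≤ c_D`
  have hstar : 8 * M ^ 2 * δ * E₁ ≤ cD := by
    have h1 : M ^ 2 * δ * E₁ ≤ (M ^ 2 + 1) * (E₁ + 1) * δ := by nlinarith [mul_nonneg hM2 hE0, mul_nonneg hM2 hδ0.le]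
    nlinarith
  constructor
  · nlinarith
  · have hsq : (η + δ * E₁) ^ 2 ≤ 2 * η ^ 2 + 2 * (δ * E₁) ^ 2 := add_sq_le_two_mul η (δ * E₁)
    have h4 : ((2 * M) * (η + δ * E₁)) ^ 2 = 4 * M ^ 2 * (η + δ * E₁) ^ 2 := by ring
    have h5 : 4 * M ^ 2 * (η + δ * E₁) ^ 2 ≤ 8 * M ^ 2 * η ^ 2 + 8 * M ^ 2 * (δ * E₁) ^ 2 := by
      nlinarith [mul_le_mul_of_nonneg_left hsq (by positivity : (0 : ℝ) ≤ 4 * M ^ 2)]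
    have h6 : 8 * M ^ 2 * η ^ 2 ≤ cD / 4 * E₁ := by nlinarith
    have h7 : 8 * M ^ 2 * (δ * E₁) ^ 2 ≤ cD / 2 * E₁ := by
      have hδE : 0 ≤ δ * E₁ := mul_nonneg hδ0.le hE0
      have h71 : 8 * M ^ 2 * (δ * E₁) ^ 2 = (8 * M ^ 2 * δ * E₁) * (δ * E₁) := by ring
      have h72 : (8 * M ^ 2 * δ * E₁) * (δ * E₁) ≤ cD * (δ * E₁) := mul_le_mul_of_nonneg_right hstar hδE
      have h73 : cD * (δ * E₁) ≤ cD * (E₁ / 2) := by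
        apply mul_le_mul_of_nonneg_left _ hcD
        nlinarith
      linarith
    nlinarith

/-- Third discrete smallness inequality (loud case).  If moreover `0 < ν`, `ν(Mη)² ≤ (c_D/32)ε₁` and
`64ν(M²+1)(E₁+1)²δ ≤ c_Dε₁`, then `ν((2M)(η + δE₁))² ≤ c_D(ε₁/2)`. [folklore] -/
theorem discrete_smallness_loud {cD M η E₁ δ ν ε₁ : ℝ} (hE0 : 0 ≤ E₁) (hν : 0 < ν) (hδ0 : 0 < δ)
    (hδhalf : δ ≤ 1 / 2) (hδB : 64 * ν * (M ^ 2 + 1) * (E₁ + 1) ^ 2 * δ ≤ cD * ε₁)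
    (hs3 : ν * (M * η) ^ 2 ≤ cD / 32 * ε₁) :
    ν * ((2 * M) * (η + δ * E₁)) ^ 2 ≤ cD * (ε₁ / 2) := by
  have hM2 : 0 ≤ M ^ 2 := sq_nonneg M
  have hsq : (η + δ * E₁) ^ 2 ≤ 2 * η ^ 2 + 2 * (δ * E₁) ^ 2 := add_sq_le_two_mul η (δ * E₁)
  have h4 : ν * ((2 * M) * (η + δ * E₁)) ^ 2 = 4 * ν * M ^ 2 * (η + δ * E₁) ^ 2 := by ring
  have hνM : 0 ≤ 4 * ν * M ^ 2 := by positivity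
  have h5 : 4 * ν * M ^ 2 * (η + δ * E₁) ^ 2 ≤ 8 * ν * M ^ 2 * η ^ 2 + 8 * ν * M ^ 2 * (δ * E₁) ^ 2 := by
    nlinarith [mul_le_mul_of_nonneg_left hsq hνM]
  have h6 : 8 * ν * M ^ 2 * η ^ 2 ≤ cD / 4 * ε₁ := by nlinarith
  have h7 : 8 * ν * M ^ 2 * (δ * E₁) ^ 2 ≤ cD / 16 * ε₁ := by
    -- `M²E₁² ≤ (M²+1)(E₁+1)²`
    have hME : M ^ 2 * E₁ ^ 2 ≤ (M ^ 2 + 1) * (E₁ + 1) ^ 2 := by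
      have hE2 : E₁ ^ 2 ≤ (E₁ + 1) ^ 2 := by nlinarith
      nlinarith [mul_nonneg hM2 (sq_nonneg (E₁ + 1))]
    have h71 : 8 * ν * M ^ 2 * (δ * E₁) ^ 2 = (8 * ν * (M ^ 2 * E₁ ^ 2) * δ) * δ := by ring
    have h72 : (8 * ν * (M ^ 2 * E₁ ^ 2) * δ) * δ ≤ (8 * ν * ((M ^ 2 + 1) * (E₁ + 1) ^ 2) * δ) * δ := by
      apply mul_le_mul_of_nonneg_right _ hδ0.le
      apply mul_le_mul_of_nonneg_right _ hδ0.le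
      nlinarith
    have h73 : (8 * ν * ((M ^ 2 + 1) * (E₁ + 1) ^ 2) * δ) = (64 * ν * (M ^ 2 + 1) * (E₁ + 1) ^ 2 * δ) / 8 := by ring
    have h74 : (8 * ν * ((M ^ 2 + 1) * (E₁ + 1) ^ 2) * δ) * δ ≤ (cD * ε₁ / 8) * δ := by
      rw [h73]
      apply mul_le_mul_of_nonneg_right _ hδ0.le
      linarith
    have hcε : 0 ≤ cD * ε₁ := by
      have : 0 ≤ 64 * ν * (M ^ 2 + 1) * (E₁ + 1) ^ 2 * δ := by positivity
      linarith
    have h75 : (cD * ε₁ / 8) * δ ≤ (cD * ε₁ / 8) * (1 / 2) := mul_le_mul_of_nonneg_left hδhalf (by positivity)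
    linarith
  nlinarith

/-! ## §2 The glue -/

/-- **Core of the glue.**  Given the Kantorovich constant `c_D` and statement, PDE data at `(ν, f, v)` and a slack `δ > 0`
whose discrete data `(η + δE₁, 2M)` already satisfy the two unconditional discrete smallness inequalities and, when
`ε₁ > 0`, the third: the conclusion of `stub_galerkinNewton` holds eventually in `N` (truncate, take the discrete inf-sup,
run the discrete Newton step with `(E, ε) := (E₁, ε₁/2)`). [folklore] -/
theorem glue_core {cD : ℝ}
    (hD : ∀ (ν E ε η M : ℝ) (N : ℕ) (f vN : UnitAddTorus (Fin 3) → EuclideanSpace ℝ (Fin 3)),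
        0 < ν → IsSmooth f → IsKField vN → IsBandLimited N vN →
        ∫ x, ‖vN x‖ ^ 2 ≤ E → ε ≤ ν * gradNormSq vN →
        (∀ a, IsKField a → IsBandLimited N a → |testedForm ν f vN a| ≤ η * Real.sqrt (gradNormSq a)) →
        (∀ w, IsKField w → IsBandLimited N w → ∃ a, IsKField a ∧ IsBandLimited N a ∧
            Real.sqrt (gradNormSq w) * Real.sqrt (gradNormSq a) ≤ M * linForm ν vN w a ∧
            (0 < gradNormSq w → 0 < gradNormSq a)) →
        M ^ 2 * η ≤ cD → (M * η) ^ 2 ≤ cD * E →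
        ∃ U : UnitAddTorus (Fin 3) → EuclideanSpace ℝ (Fin 3),
          IsKField U ∧ IsBandLimited N U ∧
          (∀ a, IsSmooth a → IsDivFree a → IsKSymm a → IsBandLimited N a → testedForm ν f U a = 0) ∧
          ∫ x, ‖U x‖ ^ 2 ≤ 2 * E ∧ (ν * (M * η) ^ 2 ≤ cD * ε → ε / 2 ≤ ν * gradNormSq U))
    {ν E₁ ε₁ η M δ : ℝ} {f v : UnitAddTorus (Fin 3) → EuclideanSpace ℝ (Fin 3)}
    (hν : 0 < ν) (hδ : 0 < δ) (hf : IsSmooth f) (hv : IsKField v) (hE : ∫ x, ‖v x‖ ^ 2 ≤ E₁)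
    (hε : ε₁ ≤ ν * gradNormSq v)
    (hres : ∀ a, IsKField a → |testedForm ν f v a| ≤ η * Real.sqrt (gradNormSq a))
    (hinf : ∀ w, IsKField w → ∃ a, IsKField a ∧
        Real.sqrt (gradNormSq w) * Real.sqrt (gradNormSq a) ≤ M * linForm ν v w a ∧
        (0 < gradNormSq w → 0 < gradNormSq a))
    (h1 : (2 * M) ^ 2 * (η + δ * E₁) ≤ cD) (h2 : ((2 * M) * (η + δ * E₁)) ^ 2 ≤ cD * E₁)
    (h3 : 0 < ε₁ → ν * ((2 * M) * (η + δ * E₁)) ^ 2 ≤ cD * (ε₁ / 2)) :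
    ∀ᶠ N in Filter.atTop, ∃ U : UnitAddTorus (Fin 3) → EuclideanSpace ℝ (Fin 3),
      IsKField U ∧ IsBandLimited N U ∧
      (∀ a, IsSmooth a → IsDivFree a → IsKSymm a → IsBandLimited N a → testedForm ν f U a = 0) ∧
      ∫ x, ‖U x‖ ^ 2 ≤ 4 * E₁ ∧ ε₁ / 4 ≤ ν * gradNormSq U := by
  have hE0 : 0 ≤ E₁ := le_trans (integral_nonneg fun x => by positivity) hE
  have hT := stub_truncation ν η E₁ ε₁ δ f v hν hδ hf hv hE hε hres
  have hC := stub_discreteInfSup ν M v hν hv hinf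
  filter_upwards [hT, hC] with N hTN hCN
  obtain ⟨hKF, hBL, hEN, hLoud, hResN⟩ := hTN
  obtain ⟨U, hUK, hUB, hUtest, hUE, hUloud⟩ :=
    hD ν E₁ (ε₁ / 2) (η + δ * E₁) (2 * M) N f (fourierTruncate N v) hν hf hKF hBL hEN hLoud hResN hCN h1 h2
  refine ⟨U, hUK, hUB, hUtest, by linarith, ?_⟩
  rcases lt_or_ge 0 ε₁ with hpos | hnonpos
  · have h := hUloud (h3 hpos)
    linarith
  · have h0 : 0 ≤ ν * gradNormSq U := mul_nonneg hν.le (gradNormSq_nonneg U)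
    linarith

/-- **stub_galerkinNewton** (the registered transfer stub of the line `stagnation-plug-froth`, stmt-AnomalousDissipation-2987):
glued from `stub_truncation`, `stub_discreteInfSup`, `stub_discreteKantorovich` with `c := c_D/32`.
(Brezzi–Rappaz–Raviart 1980 Part I + Newton–Kantorovich.) [folklore] -/
theorem stub_galerkinNewton : ∃ c : ℝ, 0 < c ∧ ∀ (ν E₁ ε₁ η M : ℝ) (f v : UnitAddTorus (Fin 3) → EuclideanSpace ℝ (Fin 3)), 0 < ν → IsSmooth f → IsKField v → ∫ x, ‖v x‖ ^ 2 ≤ E₁ → ε₁ ≤ ν * gradNormSq v → (∀ a, IsKField a → |testedForm ν f v a| ≤ η * Real.sqrt (gradNormSq a)) → (∀ w, IsKField w → ∃ a, IsKField a ∧ Real.sqrt (gradNormSq w) * Real.sqrt (gradNormSq a) ≤ M * linForm ν v w a ∧ (0 < gradNormSq w → 0 < gradNormSq a)) → M ^ 2 * η ≤ c → (M * η) ^ 2 ≤ c * E₁ → ν * (M * η) ^ 2 ≤ c * ε₁ → ∀ᶠ N in Filter.atTop, ∃ U : UnitAddTorus (Fin 3) → EuclideanSpace ℝ (Fin 3),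 IsKField U ∧ IsBandLimited N U ∧ (∀ a, IsSmooth a → IsDivFree a → IsKSymm a → IsBandLimited N a → testedForm ν f U a = 0) ∧ ∫ x, ‖U x‖ ^ 2 ≤ 4 * E₁ ∧ ε₁ / 4 ≤ ν * gradNormSq U := by
  obtain ⟨cD, hcD, hD⟩ := stub_discreteKantorovich
  refine ⟨cD / 32, by positivity, ?_⟩
  intro ν E₁ ε₁ η M f v hν hf hv hE hε hres hinf hs1 hs2 hs3
  have hE0 : 0 ≤ E₁ := le_trans (integral_nonneg fun x => by positivity) hE
  have hA : 0 < 8 * (M ^ 2 + 1) * (E₁ + 1) := by positivity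
  -- the unconditional slack
  set δ₁ : ℝ := min (1 / 2) (cD / (8 * (M ^ 2 + 1) * (E₁ + 1)))
  have hδ₁pos : 0 < δ₁ := lt_min (by norm_num) (div_pos hcD hA)
  have hδ₁half : δ₁ ≤ 1 / 2 := min_le_left _ _
  have hδ₁A : 8 * (M ^ 2 + 1) * (E₁ + 1) * δ₁ ≤ cD := by
    have h : δ₁ ≤ cD / (8 * (M ^ 2 + 1) * (E₁ + 1)) := min_le_right _ _
    rw [le_div_iff₀ hA] at h
    linarith
  rcases lt_or_ge 0 ε₁ with hpos | hnonpos
  · -- loud case: shrink the slack further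
    have hB : 0 < 64 * ν * (M ^ 2 + 1) * (E₁ + 1) ^ 2 := by positivity
    set δ : ℝ := min δ₁ (cD * ε₁ / (64 * ν * (M ^ 2 + 1) * (E₁ + 1) ^ 2))
    have hδpos : 0 < δ := lt_min hδ₁pos (div_pos (mul_pos hcD hpos) hB)
    have hδle : δ ≤ δ₁ := min_le_left _ _
    have hδhalf : δ ≤ 1 / 2 := hδle.trans hδ₁half
    have hδA : 8 * (M ^ 2 + 1) * (E₁ + 1) * δ ≤ cD :=
      (mul_le_mul_of_nonneg_left hδle hA.le).trans hδ₁A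
    have hδB : 64 * ν * (M ^ 2 + 1) * (E₁ + 1) ^ 2 * δ ≤ cD * ε₁ := by
      have h : δ ≤ cD * ε₁ / (64 * ν * (M ^ 2 + 1) * (E₁ + 1) ^ 2) := min_le_right _ _
      rw [le_div_iff₀ hB] at h
      linarith
    obtain ⟨h1, h2⟩ := discrete_smallness hE0 hδpos hδhalf hδA hs1 hs2
    have h3 := discrete_smallness_loud hE0 hν hδpos hδhalf hδB hs3
    exact glue_core hD hν hδpos hf hv hE hε hres hinf h1 h2 fun _ => h3
  · obtain ⟨h1, h2⟩ := discrete_smallness hE0 hδ₁pos hδ₁half hδ₁A hs1 hs2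
    exact glue_core hD hν hδ₁pos hf hv hE hε hres hinf h1 h2 fun hpos => absurd hpos (not_lt.2 (ge_iff_le.1 hnonpos))

end Summit.AnomalousDissipation.AnomalousDissipation.Theorems.TaylorGreenLoudGalerkinStates.GalerkinNewton

end
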